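import Literature.Probability.RandomPlanarGeometry.HexParafermionProofs
import Literature.Probability.RandomPlanarGeometry.HexDomainSingleton
import Literature.Barriers.CriticalPhenomena.ParafermionicHalfCauchyRiemann
import Mathlib.Analysis.SpecialFunctions.Complex.Arg
import HarnessLib

/-!
# The spin-shift identity of the SAW parafermionic observable (the "spin dictionary")

Topic `Literature/Probability/RandomPlanarGeometry`. For the Duminil-Copin–Smirnov observable
`F(a, z, x, σ) = Σ_{γ ⊂ Ω : a → z} e^{-iσ W_γ(a,z)} x^{ℓ(γ)}` (`hexParafermionicObservable`; H. Duminil-Copin,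
S. Smirnov, Ann. of Math. 175 (2012), arXiv:1007.0575, Definition 1) the winding `W_γ(a, z)` is "the total
rotation of the direction in radians when `γ` is traversed from `a` to `z`" (§2), so `e^{iW_γ}` is the
final unit direction divided by the initial one. The first half-segment runs along the root edge
`a = {u, w₁}` towards `w₁ ∈ Ω` (`u ∉ Ω`), the last one along the target edge `z = {v, t}`, whence for EVERY
walk `e^{2iW_γ(a,z)} = ((c t - c v)/(c w₁ - c u))²` (the square kills the sign of the side from which `z` is
reached; the trivial walk is consistent), and the observable two spin units down (up) is the observable
times a unimodular factor depending on the EDGE only: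
`F(a, {v,t}, x, σ ∓ 2) = ((c t - c v)/(c w₁ - c u))^{±2} · F(a, {v,t}, x, σ)`.
At a vertex `v` with ports in directions `ρ, ρω, ρω²` (`ω³ = 1`) the three `ℤ/3`-modes of the triple
`(F{v,w₀}, F{v,w₁}, F{v,w₂})` are therefore the STAR SUMS `Σⱼ F(a,{v,wⱼ},x,s)` at the shifted spins
`s = σ, σ - 2, σ + 2` up to unimodular factors (`starSum_spin_sub_two`, `starSum_spin_add_two`) — the exact
identity behind the winding-law form of Duminil-Copin–Smirnov's curl remark (arXiv:1007.0575 p. 7); at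
`x = x_c`, `σ = 5/8` the `σ + 2` star sum is the combination annihilated by their Lemma 1.

Contents (namespace `Literature.Probability.RandomPlanarGeometry.SAW`): `exp_arg_mul_I_eq_div_norm`,
`exp_turning_mul_I`, `lastStep`, `exp_winding_mul_I` (telescoping `e^{iW} = u(last step)/u(first step)`);
`norm_hexCenter_sub_of_adj` (`= 1/√3`), `hexCenter_ne_of_adj`; `HexMidEdgeSAW.map_chain_ne`,
`.exp_two_mul_winding_mul_I`, `.weight_spin_sub_two`, `.weight_spin_add_two`;
`hexParafermionicObservable_spin_sub_two`, `_spin_add_two`; `starSum_spin_sub_two`, `starSum_spin_add_two`.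
Everything is [folklore] finite geometry over the cited definition.
-/


noncomputable section

open Complex Literature.Probability.LatticeModels

namespace Literature.Probability.RandomPlanarGeometry.SAW

/-! ### Unit directions and the exponential of a turning angle -/

/-- `e^{i arg q} = q / |q|` for `q ≠ 0`. [folklore] -/
theorem exp_arg_mul_I_eq_div_norm {q : ℂ} (hq : q ≠ 0) :
    Complex.exp (Complex.arg q * Complex.I) = q / (‖q‖ : ℂ) := by
  have h := Complex.norm_mul_exp_arg_mul_I q
  have hn : (‖q‖ : ℂ) ≠ 0 := by exact_mod_cast (norm_ne_zero_iff.2 hq)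
  rw [eq_div_iff hn, mul_comm]
  exact h

/-- **`e^{i·turning} = u(out)/u(in)`**: the exponential of the signed turning angle at `z₂` of
`z₁ → z₂ → z₃` is the quotient of the outgoing by the incoming UNIT increments. [folklore] -/
theorem exp_turning_mul_I {z₁ z₂ z₃ : ℂ} (h₁₂ : z₁ ≠ z₂) (h₂₃ : z₂ ≠ z₃) :
    Complex.exp (turning z₁ z₂ z₃ * Complex.I) =
      ((z₃ - z₂) / (‖z₃ - z₂‖ : ℂ)) / ((z₂ - z₁) / (‖z₂ - z₁‖ : ℂ)) := by
  have ha : z₃ - z₂ ≠ 0 := sub_ne_zero.2 (Ne.symm h₂₃)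
  have hb : z₂ - z₁ ≠ 0 := sub_ne_zero.2 (Ne.symm h₁₂)
  have hq : (z₃ - z₂) / (z₂ - z₁) ≠ 0 := div_ne_zero ha hb
  rw [turning, exp_arg_mul_I_eq_div_norm hq, norm_div]
  have hna : (‖z₃ - z₂‖ : ℂ) ≠ 0 := by exact_mod_cast (norm_ne_zero_iff.2 ha)
  have hnb : (‖z₂ - z₁‖ : ℂ) ≠ 0 := by exact_mod_cast (norm_ne_zero_iff.2 hb)
  push_cast
  field_simp

/-- The last increment of the polyline `p → q → l` (`q - p` if `l = []`). [folklore] -/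
def lastStep : ℂ → ℂ → List ℂ → ℂ
  | p, q, [] => q - p
  | _, q, r :: l => lastStep q r l

/-- `lastStep` of a polyline with at least three points ignores the first point. [folklore] -/
@[simp] theorem lastStep_cons (p q r : ℂ) (l : List ℂ) : lastStep p q (r :: l) = lastStep q r l := rfl

/-- `lastStep` of a polyline ending with the segment `[y, w]` is `w - y`. [folklore] -/
theorem lastStep_eq : ∀ (l : List ℂ) (p q y w : ℂ), lastStep p q (l ++ [y, w]) = w - y
  | [], _, _, _, _ => rfl
  | r :: l, p, q, y, w => by
    rw [List.cons_append, lastStep_cons]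
    exact lastStep_eq l q r y w

/-- **Telescoping: `e^{iW} = u(last step) / u(first step)`** for a polyline whose consecutive points
are pairwise distinct — the winding is the total rotation of the direction. [folklore] -/
theorem exp_winding_mul_I : ∀ (l : List ℂ) (p q : ℂ), List.IsChain (· ≠ ·) (p :: q :: l) →
    Complex.exp (winding (p :: q :: l) * Complex.I) =
      (lastStep p q l / (‖lastStep p q l‖ : ℂ)) / ((q - p) / (‖q - p‖ : ℂ))
  | [], p, q, h => by
    have hpq : p ≠ q := (List.isChain_cons_cons.1 h).1
    have hb : q - p ≠ 0 := sub_ne_zero.2 (Ne.symm hpq)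
    have hnb : (‖q - p‖ : ℂ) ≠ 0 := by exact_mod_cast (norm_ne_zero_iff.2 hb)
    simp [lastStep, div_self (div_ne_zero hb hnb)]
  | r :: l, p, q, h => by
    obtain ⟨hpq, h'⟩ := List.isChain_cons_cons.1 h
    have hqr : q ≠ r := (List.isChain_cons_cons.1 h').1
    rw [winding_cons_cons_cons, lastStep_cons]
    push_cast
    rw [add_mul, Complex.exp_add, exp_turning_mul_I hpq hqr, exp_winding_mul_I l q r h']
    have hb : r - q ≠ 0 := sub_ne_zero.2 (Ne.symm hqr)
    have hnb : (‖r - q‖ : ℂ) ≠ 0 := by exact_mod_cast (norm_ne_zero_iff.2 hb)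
    have hu : (r - q) / (‖r - q‖ : ℂ) ≠ 0 := div_ne_zero hb hnb
    field_simp

/-! ### Lattice geometry: adjacent centres -/

/-- Adjacent vertices of `ℍ` have centres at squared distance `1/3`. [folklore] -/
theorem normSq_hexCenter_sub_of_adj' {x y : HexVertex} (h : hexGraph.Adj x y) :
    Complex.normSq (hexCenter y - hexCenter x) = 1 / 3 := by
  obtain ⟨a, i⟩ := y
  obtain ⟨b, j⟩ := x
  rw [hexCenter_sub_hexCenter, normSq_add_mul_triZeta]
  fin_cases i <;> fin_cases j
  · exact absurd h
      (Literature.Barriers.CriticalPhenomena.HexKernel.not_hexGraph_adj_of_snd_eq_holds _ _ rfl)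
  · rcases (Literature.Barriers.CriticalPhenomena.HexKernel.hexGraph_adj_iff_of_snd_eq_zero_holds
        a b).1 h.symm with rfl | rfl | rfl
    · simp; norm_num
    · simp [Pi.sub_apply]; norm_num
    · simp [Pi.sub_apply]; norm_num
  · rcases (Literature.Barriers.CriticalPhenomena.HexKernel.hexGraph_adj_iff_of_snd_eq_zero_holds
        b a).1 h with rfl | rfl | rfl
    · simp; norm_num
    · simp [Pi.sub_apply]; norm_num
    · simp [Pi.sub_apply]; norm_num
  · exact absurd h
      (Literature.Barriers.CriticalPhenomena.HexKernel.not_hexGraph_adj_of_snd_eq_holds _ _ rfl)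

/-- Adjacent vertices of `ℍ` have centres at distance `1/√3` (the honeycomb edge). [folklore] -/
theorem norm_hexCenter_sub_of_adj {x y : HexVertex} (h : hexGraph.Adj x y) :
    ‖hexCenter y - hexCenter x‖ = (Real.sqrt 3)⁻¹ := by
  rw [← Real.sqrt_sq (norm_nonneg _), Complex.sq_norm, normSq_hexCenter_sub_of_adj' h, one_div,
    Real.sqrt_inv]

/-- Adjacent vertices have distinct centres. [folklore] -/
theorem hexCenter_ne_of_adj {x y : HexVertex} (h : hexGraph.Adj x y) : hexCenter x ≠ hexCenter y := by
  intro he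
  have := norm_hexCenter_sub_of_adj h
  rw [he, sub_self, norm_zero] at this
  exact (inv_ne_zero (Real.sqrt_ne_zero'.2 (by norm_num))) this.symm

/-! ### The spin shift of a single walk -/

namespace HexMidEdgeSAW

variable {Λ : Finset HexVertex} {a : Sym2 HexVertex} {u w₁ v t : HexVertex}

/-- Consecutive points of the polyline `c(v₁), …, c(vₙ), mid(z)` of a walk are distinct (chain form,
for any prefix point `p ≠ c(v₁)`). [folklore] -/
theorem map_chain_ne (γ : HexMidEdgeSAW Λ a s(v, t)) (hvt : hexGraph.Adj v t) (hne : γ.verts ≠ []) :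
    ∀ p : ℂ, (∀ x, γ.verts.head? = some x → p ≠ hexCenter x) →
      List.IsChain (· ≠ ·) (p :: (γ.verts.map hexCenter ++ [hexMidpoint s(v, t)])) := by
  -- generic statement over chains of adjacent vertices ending on `z`
  suffices H : ∀ (L : List HexVertex), L ≠ [] → L.IsChain hexGraph.Adj →
      (∀ x, L.getLast? = some x → x ∈ s(v, t)) →
      ∀ p : ℂ, (∀ x, L.head? = some x → p ≠ hexCenter x) →
        List.IsChain (· ≠ ·) (p :: (L.map hexCenter ++ [hexMidpoint s(v, t)])) from
    H γ.verts hne γ.isChain γ.getLast_mem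
  intro L
  induction L with
  | nil => intro h; exact absurd rfl h
  | cons x L ih =>
    intro _ hchain hlast p hp
    rcases L with _ | ⟨y, L⟩
    · -- last vertex `x ∈ {v, t}`: `c x ≠ mid {v,t}`
      have hx : x ∈ s(v, t) := hlast x rfl
      simp only [List.map_cons, List.map_nil, List.nil_append, List.cons_append]
      refine List.IsChain.cons_cons (hp x rfl) (List.IsChain.cons_cons ?_ (List.isChain_singleton _))
      rw [hexMidpoint_mk]
      have hvt' := hexCenter_ne_of_adj hvt
      rcases Sym2.mem_iff.1 hx with rfl | rfl
      · intro he
        apply hvt'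
        linear_combination (2 : ℂ) * he
      · intro he
        apply hvt'
        linear_combination (-2 : ℂ) * he
    · have hxy : hexGraph.Adj x y := (List.isChain_cons_cons.1 hchain).1
      have hchain' : (y :: L).IsChain hexGraph.Adj := (List.isChain_cons_cons.1 hchain).2
      have ih' := ih (List.cons_ne_nil _ _) hchain' (fun z hz => hlast z (by
        simpa [List.getLast?_cons_cons] using hz)) (hexCenter x)
        (fun z hz => by
          simp only [List.head?_cons, Option.some.injEq] at hz
          subst hz
          exact hexCenter_ne_of_adj hxy)
      simp only [List.map_cons, List.cons_append] at ih' ⊢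
      exact List.IsChain.cons_cons (hp x rfl) ih'

/-- **`e^{2iW_γ} = ((c t - c v)/(c w₁ - c u))²`** for every walk `γ : {u,w₁} → {v,t}` of a domain
not containing `u` (so `γ` starts at `w₁`), `v ∼ t`: the winding rotates the initial direction
`u → w₁` onto the final direction `±(v → t)`. [folklore] -/
theorem exp_two_mul_winding_mul_I (γ : HexMidEdgeSAW Λ a s(v, t)) (ha : a = s(u, w₁)) (hu : u ∉ Λ)
    (hvt : hexGraph.Adj v t) :
    Complex.exp (2 * (γ.winding : ℂ) * Complex.I) =
      ((hexCenter t - hexCenter v) / (hexCenter w₁ - hexCenter u)) ^ 2 := by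
  -- adjacency of the root edge
  have huw : hexGraph.Adj u w₁ := by
    have h := γ.fst_mem.1
    rw [ha] at h
    simpa using h
  have hcu : hexCenter w₁ - hexCenter u ≠ 0 := sub_ne_zero.2 (hexCenter_ne_of_adj huw).symm
  have hcv : hexCenter t - hexCenter v ≠ 0 := sub_ne_zero.2 (hexCenter_ne_of_adj hvt).symm
  by_cases hne : γ.verts = []
  · -- the trivial walk: `a = {v,t}`, winding `0`, ratio `±1`
    have haz : a = s(v, t) := γ.eq_of_nil hne
    have hw0 : γ.winding = 0 := by simp [HexMidEdgeSAW.winding, HexMidEdgeSAW.points, hne]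
    rw [hw0]
    simp only [Complex.ofReal_zero, mul_zero, zero_mul, Complex.exp_zero]
    rw [ha] at haz
    rcases Sym2.eq_iff.1 haz with ⟨rfl, rfl⟩ | ⟨rfl, rfl⟩
    · rw [div_self hcv, one_pow]
    · rw [show hexCenter u - hexCenter w₁ = -(hexCenter w₁ - hexCenter u) by ring, neg_div,
        div_self hcu]
      norm_num
  · -- a genuine walk: telescoping over the polyline `mid a, c v₁, …, c vₙ, mid z`
    have hhead := γ.head_eq ha hu hne
    obtain ⟨x₀, rest, hx₀⟩ := List.exists_cons_of_ne_nil hne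
    have hx₁ : x₀ = w₁ := by rw [← hhead]; simp [hx₀]
    have hx : γ.verts = w₁ :: rest := by rw [hx₀, hx₁]
    clear hx₀ hx₁
    -- the chain of distinct consecutive points
    have hchain : List.IsChain (· ≠ ·)
        (hexMidpoint a :: (γ.verts.map hexCenter ++ [hexMidpoint s(v, t)])) := by
      refine γ.map_chain_ne hvt hne (hexMidpoint a) (fun y hy => ?_)
      rw [hx] at hy
      simp only [List.head?_cons, Option.some.injEq] at hy
      subst hy
      rw [ha, hexMidpoint_mk]
      intro he
      apply hexCenter_ne_of_adj huw
      linear_combination (2 : ℂ) * he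
    have hpts : γ.points = hexMidpoint a :: (γ.verts.map hexCenter ++ [hexMidpoint s(v, t)]) := rfl
    -- first increment
    have hfirst : hexCenter w₁ - hexMidpoint a = (1 / 2 : ℂ) * (hexCenter w₁ - hexCenter u) := by
      rw [ha, hexMidpoint_mk]; ring
    -- last increment: write `verts = L₀ ++ [g]` with `g ∈ {v, t}`
    obtain ⟨L₀, g, hLg⟩ : ∃ L₀ g, γ.verts = L₀ ++ [g] :=
      ⟨_, _, (List.dropLast_append_getLast hne).symm⟩
    have hg : g ∈ s(v, t) := γ.getLast_mem g (by rw [hLg]; simp)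
    have hlast : lastStep (hexMidpoint a) (hexCenter w₁)
        ((rest.map hexCenter) ++ [hexMidpoint s(v, t)]) = hexMidpoint s(v, t) - hexCenter g := by
      -- `w₁ :: rest = L₀ ++ [g]`
      have hwr : w₁ :: rest = L₀ ++ [g] := by rw [← hx, hLg]
      rcases L₀ with _ | ⟨y, L₁⟩
      · simp only [List.nil_append, List.cons.injEq] at hwr
        obtain ⟨rfl, rfl⟩ := hwr
        simp [lastStep]
      · simp only [List.cons_append, List.cons.injEq] at hwr
        obtain ⟨rfl, rfl⟩ := hwr
        rw [List.map_append, List.map_cons, List.map_nil, List.append_assoc, List.singleton_append]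
        exact lastStep_eq _ _ _ _ _
    have hexpW := exp_winding_mul_I ((rest.map hexCenter) ++ [hexMidpoint s(v, t)])
      (hexMidpoint a) (hexCenter w₁) (by simpa [hx] using hchain)
    have hW : γ.winding = Literature.Probability.LatticeModels.winding (hexMidpoint a :: hexCenter w₁ ::
        ((rest.map hexCenter) ++ [hexMidpoint s(v, t)])) := by
      rw [HexMidEdgeSAW.winding, hpts, hx]; rfl
    rw [hlast, hfirst] at hexpW
    -- the last increment is `± (c t - c v)/2`
    have hlast' : ∃ ε : ℂ, (ε = 1 ∨ ε = -1) ∧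
        hexMidpoint s(v, t) - hexCenter g = ε * ((1 / 2 : ℂ) * (hexCenter t - hexCenter v)) := by
      rw [hexMidpoint_mk]
      rcases Sym2.mem_iff.1 hg with rfl | rfl
      · exact ⟨1, Or.inl rfl, by ring⟩
      · exact ⟨-1, Or.inr rfl, by ring⟩
    obtain ⟨ε, hε, hle⟩ := hlast'
    have hε2 : ε ^ 2 = 1 := by rcases hε with rfl | rfl <;> norm_num
    have hεn : ‖ε‖ = 1 := by rcases hε with rfl | rfl <;> simp
    -- square the telescoping identity
    have h2 : Complex.exp (2 * (γ.winding : ℂ) * Complex.I) =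
        (Complex.exp (Literature.Probability.LatticeModels.winding (hexMidpoint a :: hexCenter w₁ ::
          ((rest.map hexCenter) ++ [hexMidpoint s(v, t)])) * Complex.I)) ^ 2 := by
      rw [← hW, ← Complex.exp_nat_mul]; congr 1; push_cast; ring
    rw [h2, hexpW, hle]
    have hn1 : ‖ε * ((1 / 2 : ℂ) * (hexCenter t - hexCenter v))‖ =
        (1 / 2 : ℝ) * ‖hexCenter t - hexCenter v‖ := by
      rw [norm_mul, hεn, one_mul, norm_mul]; norm_num
    have hn2 : ‖(1 / 2 : ℂ) * (hexCenter w₁ - hexCenter u)‖ = (1 / 2 : ℝ) * ‖hexCenter w₁ - hexCenter u‖ := by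
      rw [norm_mul]; norm_num
    rw [hn1, hn2, norm_hexCenter_sub_of_adj hvt, norm_hexCenter_sub_of_adj huw]
    have h3 : ((Real.sqrt 3)⁻¹ : ℂ) ≠ 0 := by
      exact_mod_cast inv_ne_zero (Real.sqrt_ne_zero'.2 (by norm_num))
    push_cast
    field_simp
    rw [hε2]

/-- **The spin shift of one walk**: `e^{-i(σ-2)W} x^ℓ = ((c t - c v)/(c w₁ - c u))² · e^{-iσW} x^ℓ`.
[folklore] -/
theorem weight_spin_sub_two (γ : HexMidEdgeSAW Λ a s(v, t)) (ha : a = s(u, w₁)) (hu : u ∉ Λ)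
    (hvt : hexGraph.Adj v t) (x σ : ℝ) :
    γ.weight x (σ - 2) =
      ((hexCenter t - hexCenter v) / (hexCenter w₁ - hexCenter u)) ^ 2 * γ.weight x σ := by
  rw [HexMidEdgeSAW.weight, HexMidEdgeSAW.weight, ← γ.exp_two_mul_winding_mul_I ha hu hvt,
    ← mul_assoc, ← Complex.exp_add]
  congr 2
  push_cast
  ring

/-- **The opposite spin shift**: `e^{-i(σ+2)W} x^ℓ = ((c w₁ - c u)/(c t - c v))² · e^{-iσW} x^ℓ`.
[folklore] -/
theorem weight_spin_add_two (γ : HexMidEdgeSAW Λ a s(v, t)) (ha : a = s(u, w₁)) (hu : u ∉ Λ)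
    (hvt : hexGraph.Adj v t) (x σ : ℝ) :
    γ.weight x (σ + 2) =
      ((hexCenter w₁ - hexCenter u) / (hexCenter t - hexCenter v)) ^ 2 * γ.weight x σ := by
  have huw : hexGraph.Adj u w₁ := by
    have h := γ.fst_mem.1
    rw [ha] at h
    simpa using h
  have hcu : hexCenter w₁ - hexCenter u ≠ 0 := sub_ne_zero.2 (hexCenter_ne_of_adj huw).symm
  have hcv : hexCenter t - hexCenter v ≠ 0 := sub_ne_zero.2 (hexCenter_ne_of_adj hvt).symm
  have h := γ.weight_spin_sub_two ha hu hvt x (σ + 2)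
  rw [show σ + 2 - 2 = σ by ring] at h
  rw [h, ← mul_assoc, ← mul_pow, div_mul_div_comm, mul_comm (hexCenter w₁ - hexCenter u),
    div_self (mul_ne_zero hcv hcu), one_pow, one_mul]

end HexMidEdgeSAW

/-! ### The spin shift of the observable -/

/-- **Spin dictionary, `σ ↦ σ - 2`**: for a root `a = {u, w₁}` with `u ∉ Λ` and an edge `{v, t}`,
`F(a, {v,t}, x, σ - 2) = ((c t - c v)/(c w₁ - c u))² · F(a, {v,t}, x, σ)` — the observable two spin
units down is the observable times a unimodular factor depending on the edge only. [folklore] -/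
theorem hexParafermionicObservable_spin_sub_two {Λ : Finset HexVertex} {u w₁ v t : HexVertex}
    (hu : u ∉ Λ) (hvt : hexGraph.Adj v t) (x σ : ℝ) :
    hexParafermionicObservable Λ s(u, w₁) x (σ - 2) s(v, t) =
      ((hexCenter t - hexCenter v) / (hexCenter w₁ - hexCenter u)) ^ 2 *
        hexParafermionicObservable Λ s(u, w₁) x σ s(v, t) := by
  rw [hexParafermionicObservable, hexParafermionicObservable, Finset.mul_sum]
  exact Finset.sum_congr rfl fun γ _ => γ.weight_spin_sub_two rfl hu hvt x σ

/-- **Spin dictionary, `σ ↦ σ + 2`**: `F(a, {v,t}, x, σ + 2) = ((c w₁ - c u)/(c t - c v))² · F(a, {v,t}, x, σ)`.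
[folklore] -/
theorem hexParafermionicObservable_spin_add_two {Λ : Finset HexVertex} {u w₁ v t : HexVertex}
    (hu : u ∉ Λ) (hvt : hexGraph.Adj v t) (x σ : ℝ) :
    hexParafermionicObservable Λ s(u, w₁) x (σ + 2) s(v, t) =
      ((hexCenter w₁ - hexCenter u) / (hexCenter t - hexCenter v)) ^ 2 *
        hexParafermionicObservable Λ s(u, w₁) x σ s(v, t) := by
  rw [hexParafermionicObservable, hexParafermionicObservable, Finset.mul_sum]
  exact Finset.sum_congr rfl fun γ _ => γ.weight_spin_add_two rfl hu hvt x σ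

/-! ### Star sums at a vertex: the three `ℤ/3`-modes are spin-shifted star sums -/

/-- **The spin `σ-2` star sum is the mode `F₀ + ω² F₁ + ω F₂`** (up to the unimodular factor
`(ρ/d)²`): if the ports of `v` satisfy `c p₁ - c v = ω (c p₀ - c v)`, `c p₂ - c v = ω² (c p₀ - c v)`,
`ω³ = 1`, then `Σⱼ F(a,{v,pⱼ},x,σ-2) = ((c p₀ - c v)/(c w₁ - c u))² (F₀ + ω² F₁ + ω F₂)`,
`Fⱼ = F(a,{v,pⱼ},x,σ)` (note `ω⁴ = ω`). [folklore] -/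
theorem starSum_spin_sub_two {Λ : Finset HexVertex} {u w₁ v p₀ p₁ p₂ : HexVertex} {ω : ℂ}
    (hu : u ∉ Λ) (h₀ : hexGraph.Adj v p₀) (h₁ : hexGraph.Adj v p₁) (h₂ : hexGraph.Adj v p₂)
    (hω : ω ^ 3 = 1) (hd₁ : hexCenter p₁ - hexCenter v = ω * (hexCenter p₀ - hexCenter v))
    (hd₂ : hexCenter p₂ - hexCenter v = ω ^ 2 * (hexCenter p₀ - hexCenter v)) (x σ : ℝ) :
    hexParafermionicObservable Λ s(u, w₁) x (σ - 2) s(v, p₀) +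
        hexParafermionicObservable Λ s(u, w₁) x (σ - 2) s(v, p₁) +
        hexParafermionicObservable Λ s(u, w₁) x (σ - 2) s(v, p₂) =
      ((hexCenter p₀ - hexCenter v) / (hexCenter w₁ - hexCenter u)) ^ 2 *
        (hexParafermionicObservable Λ s(u, w₁) x σ s(v, p₀) +
          ω ^ 2 * hexParafermionicObservable Λ s(u, w₁) x σ s(v, p₁) +
          ω * hexParafermionicObservable Λ s(u, w₁) x σ s(v, p₂)) := by
  rw [hexParafermionicObservable_spin_sub_two hu h₀, hexParafermionicObservable_spin_sub_two hu h₁,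
    hexParafermionicObservable_spin_sub_two hu h₂, hd₁, hd₂]
  have hω4 : ω ^ 4 = ω := by
    calc ω ^ 4 = ω ^ 3 * ω := by ring
      _ = ω := by rw [hω, one_mul]
  rw [mul_div_assoc, mul_div_assoc, mul_pow, mul_pow, ← pow_mul, show 2 * 2 = 4 by norm_num, hω4]
  ring

/-- **The spin `σ+2` star sum is the mode `F₀ + ω F₁ + ω² F₂`** (up to `(d/ρ)²`), ports as in
`starSum_spin_sub_two`: `Σⱼ F(a,{v,pⱼ},x,σ+2) = ((c w₁ - c u)/(c p₀ - c v))² (F₀ + ω F₁ + ω² F₂)` — at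
`x = x_c`, `σ = 5/8` the combination that Duminil-Copin–Smirnov's Lemma 1 annihilates. [folklore] -/
theorem starSum_spin_add_two {Λ : Finset HexVertex} {u w₁ v p₀ p₁ p₂ : HexVertex} {ω : ℂ}
    (hu : u ∉ Λ) (h₀ : hexGraph.Adj v p₀) (h₁ : hexGraph.Adj v p₁) (h₂ : hexGraph.Adj v p₂)
    (hω : ω ^ 3 = 1) (hd₁ : hexCenter p₁ - hexCenter v = ω * (hexCenter p₀ - hexCenter v))
    (hd₂ : hexCenter p₂ - hexCenter v = ω ^ 2 * (hexCenter p₀ - hexCenter v)) (x σ : ℝ) :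
    hexParafermionicObservable Λ s(u, w₁) x (σ + 2) s(v, p₀) +
        hexParafermionicObservable Λ s(u, w₁) x (σ + 2) s(v, p₁) +
        hexParafermionicObservable Λ s(u, w₁) x (σ + 2) s(v, p₂) =
      ((hexCenter w₁ - hexCenter u) / (hexCenter p₀ - hexCenter v)) ^ 2 *
        (hexParafermionicObservable Λ s(u, w₁) x σ s(v, p₀) +
          ω * hexParafermionicObservable Λ s(u, w₁) x σ s(v, p₁) +
          ω ^ 2 * hexParafermionicObservable Λ s(u, w₁) x σ s(v, p₂)) := by
  rw [hexParafermionicObservable_spin_add_two hu h₀, hexParafermionicObservable_spin_add_two hu h₁,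
    hexParafermionicObservable_spin_add_two hu h₂, hd₁, hd₂]
  -- `1/ω² = ω`, `1/ω⁴ = ω²`
  have hω2 : (ω ^ 2)⁻¹ = ω := by
    symm; apply eq_inv_of_mul_eq_one_left
    calc ω * ω ^ 2 = ω ^ 3 := by ring
      _ = 1 := hω
  have hω4 : (ω ^ 4)⁻¹ = ω ^ 2 := by
    symm; apply eq_inv_of_mul_eq_one_left
    calc ω ^ 2 * ω ^ 4 = (ω ^ 3) ^ 2 := by ring
      _ = 1 := by rw [hω, one_pow]
  set d := hexCenter w₁ - hexCenter u
  set ρ := hexCenter p₀ - hexCenter v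
  have hinv1 : (d / (ω * ρ)) ^ 2 = ω * (d / ρ) ^ 2 := by
    rw [div_mul_eq_div_div_swap, div_pow, div_pow, div_eq_mul_inv _ (ω ^ 2), hω2]; ring
  have hinv2 : (d / (ω ^ 2 * ρ)) ^ 2 = ω ^ 2 * (d / ρ) ^ 2 := by
    rw [div_mul_eq_div_div_swap, div_pow, div_pow, ← pow_mul, show 2 * 2 = 4 by norm_num,
      div_eq_mul_inv _ (ω ^ 4), hω4]; ring
  rw [hinv1, hinv2]
  ring

end Literature.Probability.RandomPlanarGeometry.SAW

end
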